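import Mathlib
import HarnessLib
import Summits.AnomalousDissipation.Statement
import Summits.AnomalousDissipation.AnomalousDissipation.Theses.MomentParity
import Literature.Analysis.FluidPDE.StatisticalSolution
import Literature.Analysis.FunctionSpaces.TorusTrigPoly

/-!
# Sketch — crux-ideate round 1, ideator 3, crux `MomentParity.MomentLadder`
(stmt-AnomalousDissipation-11463). First lemmas of the two idea cards

* card A `enstrophy-ui-resolution`  — the κ-clause (N-uniform resolution of the dissipation)
  is EQUIVALENT to uniform integrability of the enstrophy `Z = ‖∇u‖²` under the loud level-N
  measures; lever = the N-uniform WEIGHTED palinstrophy bound `ν ∫ |Au|²/(1+Z)² dμ ≤ C(ν,f,R)`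
  (stationarity of `-1/(1+Z)`, FMRT 2001 Ch. II App. B (B.9)–(B.12)) which localises the
  enstrophy in `k` for free on calm events (`Z_K ≤ |Au|²/(4π²K²)`).
* card B `input-continuity-n-free` — the LOUD half of the crux is N-free: energy is `k`-tight
  uniformly in N at fixed ν (`|Q_K u|² ≤ Z/(4π²(K²+1))`), input `(f,ū)` and energy pass to
  Galerkin (Vishik–Fursikov) limits with equality, dissipation = input at Galerkin level.

Nothing here is an item; these are the `First lemma:` signatures of the cards (they elaborate;
proofs are not claimed except where given).
-/

open MeasureTheory Filter Topology Set
open scoped ENNReal NNReal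

noncomputable section

namespace Summit.AnomalousDissipation.AnomalousDissipation.Cruxes.MomentLadder.Ideate3

open Literature.Analysis.FunctionSpaces Literature.Analysis.FluidPDE

local notation "𝕋³" => UnitAddTorus (Fin 3)
local notation "E³" => EuclideanSpace ℝ (Fin 3)
local notation "H³" => Literature.Analysis.FunctionSpaces.Torus.energySpace (Fin 3)

/-! ### Shorthands (all over existing declarations) -/

/-- Spectral enstrophy `Z(u) = ‖∇u‖₂² = 4π² Σ |k|² |û(k)|² ∈ [0,∞]`. -/
abbrev Z (u : 𝕋³ → E³) : ℝ≥0∞ := Torus.eGradNormSq u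

/-- Spectral palinstrophy `|Au|² = 16π⁴ Σ_{k≠0} |k|⁴ |û(k)|² ∈ [0,∞]` (Stokes = −Δ on the flat torus). -/
abbrev Pal (u : 𝕋³ → E³) : ℝ≥0∞ :=
  ENNReal.ofReal (16 * Real.pi ^ 4) * Torus.eHomSobolevSeminorm 2 (EuclideanSpace.complexify ∘ u) ^ 2

/-- `μ` is carried by the level-`N` Fourier–Galerkin fields (the clause of `MomentLadder`). -/
def IsLevel (N : ℕ) (μ : Measure H³) : Prop :=
  ∀ᵐ (u : H³) ∂μ, ∀ k ∉ (Torus.freqBall N).erase (0 : Fin 3 → ℤ),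
    UnitAddTorus.mFourierCoeff (EuclideanSpace.complexify ∘ (u.1 : 𝕋³ → E³)) k = 0

/-- `d`-stationarity for Galerkin NS at `(ν, f)`, level `N`: the generator annihilates every
polynomial cylindrical observable of degree `≤ d − 1` with band-limited smooth solenoidal test
fields (verbatim the clause of `MomentLadder`). -/
def IsPolyStationaryUpTo (ν : ℝ) (f : 𝕋³ → E³) (N d : ℕ) (μ : Measure H³) : Prop :=
  ∀ (m : ℕ) (g : Fin m → 𝕋³ → E³) (P : MvPolynomial (Fin m) ℝ),
    (∀ i, (Torus.IsSmooth (g i) ∧ Torus.IsDivFree (g i) ∧ Torus.HasZeroMean (g i) ∧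
      (∀ k ∉ (Torus.freqBall N).erase (0 : Fin 3 → ℤ),
        UnitAddTorus.mFourierCoeff (EuclideanSpace.complexify ∘ (g i)) k = 0))) →
    P.totalDegree + 1 ≤ d →
      Integrable (fun u => Torus.nsGeneratorPairing ν f u (fun x => ∑ i : Fin m,
        (MvPolynomial.eval (fun j => Torus.pairing u.1 (g j)) (MvPolynomial.pderiv i P)) • g i x)) μ ∧
      ∫ u, Torus.nsGeneratorPairing ν f u (fun x => ∑ i : Fin m,
        (MvPolynomial.eval (fun j => Torus.pairing u.1 (g j)) (MvPolynomial.pderiv i P)) • g i x) ∂μ = 0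

/-- Stationarity against polynomial cylindrical observables of ALL degrees (the clause of
`GalerkinInvariantLoud`; on compactly supported level-N measures = flow invariance). -/
def IsPolyStationary (ν : ℝ) (f : 𝕋³ → E³) (N : ℕ) (μ : Measure H³) : Prop :=
  ∀ d : ℕ, IsPolyStationaryUpTo ν f N d μ

/-- The resolution clause of `MomentLadder` with schedule `κ` (verbatim). -/
def IsResolved (κ : ℕ → ℕ) (μ : Measure H³) : Prop :=
  ∀ n : ℕ, ∫⁻ (u : H³), Z (u.1 : 𝕋³ → E³) ∂μ ≤
    (∫⁻ (u : H³), Z (Torus.fourierTruncate (κ n) (u.1 : 𝕋³ → E³)) ∂μ) + ((n : ℝ≥0∞) + 1)⁻¹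

/-! ### Card A — `enstrophy-ui-resolution` -/

/-- **A1 (deterministic, provable now).** Enstrophy tail beyond the ball `|k| ≤ K` is at most
palinstrophy `/ (4π²(K²+1))`: `Z(u) ≤ Z(P_K u) + |Au|²/(4π²(K²+1))` — `|k|² ≤ |k|⁴/(K²+1)` off
the ball, Parseval. -/
def TailLePalinstrophy : Prop :=
  ∀ (K : ℕ) (u : 𝕋³ → E³), Integrable u volume →
    Z u ≤ Z (Torus.fourierTruncate K u) +
      (ENNReal.ofReal (4 * Real.pi ^ 2 * ((K : ℝ) ^ 2 + 1)))⁻¹ * Pal u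

/-- **A2 (the lever; N-uniform weighted palinstrophy bound).** For invariant level-`N` measures
supported in `‖u‖ ≤ R`: `∫ |Au|²/(1+Z)² dμ ≤ C(ν,f,R)` with `C` INDEPENDENT of `N`
(stationarity of the bounded `C¹` observable `−1/(1+Z)` — reached from polynomial observables by
`C¹`-density on the compact ball `P_N H ∩ B_R` — then `|b(u,u,Au)| ≤ c Z^{3/4}|Au|^{3/2}`,
Young, and `ν ∫ Z dμ = ∫ (f,u) dμ ≤ |f| R`; FMRT 2001 Ch. II App. B (B.9)–(B.11) is the
trajectory version). -/
def WeightedPalinstrophyBound : Prop :=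
  ∀ f : 𝕋³ → E³, Torus.IsSmooth f → Torus.IsDivFree f → Torus.HasZeroMean f →
    ∀ ν : ℝ, 0 < ν → ∀ R : ℝ, ∃ C : ℝ≥0∞, C < ⊤ ∧
      ∀ (N : ℕ) (μ : Measure H³), IsProbabilityMeasure μ → IsLevel N μ →
        (∀ᵐ u ∂μ, ‖u‖ ≤ R) → IsPolyStationary ν f N μ →
          ∫⁻ (u : H³), Pal (u.1 : 𝕋³ → E³) / (1 + Z (u.1 : 𝕋³ → E³)) ^ 2 ∂μ ≤ C

/-- **A3 (transfer `C⁺ → κ-clause`: uniform integrability ⇒ N-uniform resolution).** Given a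
modulus `ω(M) → 0`, ONE schedule `κ = κ(f, ν, R, ω)` resolves EVERY invariant level-`N` measure in
the ball whose enstrophy has UI-modulus `ω` (`∫_{Z>M} Z dμ ≤ ω M`): by A1–A2,
`∫ Z_K dμ ≤ (1+M)² C/(4π²ν… (K²+1)) + ω(M)`; choose `M = M(n)` then `K = κ(n)`. -/
def UIResolution : Prop :=
  ∀ f : 𝕋³ → E³, Torus.IsSmooth f → Torus.IsDivFree f → Torus.HasZeroMean f →
    ∀ ν : ℝ, 0 < ν → ∀ (R : ℝ) (ω : ℕ → ℝ≥0∞), Tendsto ω atTop (𝓝 0) →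
      ∃ κ : ℕ → ℕ, ∀ (N : ℕ) (μ : Measure H³), IsProbabilityMeasure μ → IsLevel N μ →
        (∀ᵐ u ∂μ, ‖u‖ ≤ R) → IsPolyStationary ν f N μ →
          (∀ M : ℕ, ∫⁻ (u : H³) in {u : H³ | (M : ℝ≥0∞) < Z (u.1 : 𝕋³ → E³)},
              Z (u.1 : 𝕋³ → E³) ∂μ ≤ ω M) →
            IsResolved κ μ

/-- **A4 (converse, three lines from `‖u‖ ≤ R`).** A resolved measure in the ball is uniformly
integrable with the explicit modulus `2/(n+1)` at level `M_n = 8π²κ(n)²R²`: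
`Z ≤ Z(P_κ u) + Z_κ ≤ 4π²κ²R² + Z_κ`, so `Z > 2·4π²κ²R² ⇒ Z ≤ 2 Z_κ`. Hence UI ⟺ resolution. -/
def ResolutionUI : Prop :=
  ∀ (R : ℝ) (κ : ℕ → ℕ) (μ : Measure H³), IsProbabilityMeasure μ → (∀ᵐ u ∂μ, ‖u‖ ≤ R) →
    IsResolved κ μ →
      ∀ n : ℕ, ∫⁻ (u : H³) in {u : H³ | ENNReal.ofReal (8 * Real.pi ^ 2 * (κ n : ℝ) ^ 2 * R ^ 2) <
          Z (u.1 : 𝕋³ → E³)}, Z (u.1 : 𝕋³ → E³) ∂μ ≤ 2 * ((n : ℝ≥0∞) + 1)⁻¹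

/-- **A5 (de la Vallée-Poussin form of the new crux input).** A superlinear enstrophy moment,
uniform in `N`, along the loud family: the cheapest sufficient condition for the κ-clause
(`Ψ(x) = x^{3/2}` is the "cubic enstrophy-norm moment"; `x log(1+x)` also suffices). Stated as the
strengthening of `GalerkinInvariantLoud` it would replace `ResolvedDissipation` by. -/
def GalerkinInvariantLoudUI : Prop :=
  ∃ f : 𝕋³ → E³, Torus.IsSmooth f ∧ Torus.IsDivFree f ∧ Torus.HasZeroMean f ∧
    ∃ (ν : ℕ → ℝ) (E ε : ℝ) (Ψ : ℝ≥0∞ → ℝ≥0∞),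
      (∀ j, 0 < ν j) ∧ Tendsto ν atTop (𝓝 0) ∧ 0 < ε ∧
      Tendsto (fun x : ℝ≥0∞ => Ψ x / x) (𝓝[≠] ⊤) (𝓝 ⊤) ∧
      ∀ j : ℕ, ∃ (R : ℝ) (B : ℝ≥0∞), B < ⊤ ∧ ∃ᶠ N in atTop, ∃ μ : Measure H³,
        IsProbabilityMeasure μ ∧ IsLevel N μ ∧ (∀ᵐ u ∂μ, ‖u‖ ≤ R) ∧
        IsPolyStationary (ν j) f N μ ∧
        ∫⁻ (u : H³), Ψ (Z (u.1 : 𝕋³ → E³)) ∂μ ≤ B ∧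
        Torus.ensembleEnergy μ ≤ E ∧ ε ≤ Torus.ensembleDissipation (ν j) μ

/-- Glue of card A (pure logic + A3 + de la Vallée-Poussin, modulo `MomentClosure`-type density):
the UI-strengthened loud rung implies the crux. Recorded as a `Prop`; not claimed proved here. -/
def CardA_Glue : Prop :=
  UIResolution → GalerkinInvariantLoudUI →
    Summit.AnomalousDissipation.AnomalousDissipation.Theses.MomentParity.MomentLadder

/-! ### Card B — `input-continuity-n-free` -/

/-- **B1 (deterministic, essentially in tree: `Torus.lintegral_enorm_sq_fourierTruncate_sub`).**
Energy above the ball `|k| ≤ K` is at most `Z/(4π²(K²+1))` — energy is `k`-tight wherever the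
mean enstrophy is bounded, hence uniformly in `N` at fixed `ν` for invariant Galerkin measures
(`ν ∫ Z dμ = ∫ (f,u) dμ ≤ |f| R`). -/
def EnergyTailLeEnstrophy : Prop :=
  ∀ (K : ℕ) (u : 𝕋³ → E³), MemLp u 2 volume →
    ∫⁻ x, ‖u x - Torus.fourierTruncate K u x‖ₑ ^ 2 ≤
      (ENNReal.ofReal (4 * Real.pi ^ 2 * ((K : ℝ) ^ 2 + 1)))⁻¹ * Z u

/-- **B2 (input = dissipation at Galerkin level).** For a 3-stationary level-`N` probability
measure in a ball, `ν ∫ Z dμ = ∫ (f,u) dμ` (stationarity of the degree-2 observable `|u|²`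
written in a band-limited solenoidal basis). Loudness of `MomentLadder`/`GalerkinInvariantLoud`
is therefore a statement about the INPUT functional `μ ↦ ∫ (f,u) dμ`, which is weakly continuous. -/
def InputEqDissipation : Prop :=
  ∀ f : 𝕋³ → E³, Torus.IsSmooth f → Torus.IsDivFree f → Torus.HasZeroMean f →
    ∀ (ν R : ℝ) (N : ℕ) (μ : Measure H³), IsProbabilityMeasure μ → IsLevel N μ →
      (∀ᵐ u ∂μ, ‖u‖ ≤ R) → IsPolyStationaryUpTo ν f N 3 μ →
        Torus.ensembleDissipation ν μ = ∫ (u : H³), Torus.pairing u.1 f ∂μ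

/-- A Galerkin-limit (Vishik–Fursikov / FMRT time-average-type) stationary measure at `(ν, f)`
with support radius `R`: a narrow limit, in the norm topology of `H` (tightness holds there:
`{Z ≤ M} ∩ B_R` is compact in `H` and `μ_N(Z > M) ≤ |f|R/(νM)`), of invariant level-`N_i`
probability measures in the ball, `N_i → ∞`. Inlined because the tree has no VF vocabulary. -/
def IsGalerkinLimit (ν : ℝ) (f : 𝕋³ → E³) (R : ℝ) (μ : Measure H³) : Prop :=
  ∃ (Ns : ℕ → ℕ) (μs : ℕ → Measure H³), Tendsto Ns atTop atTop ∧
    (∀ i, IsProbabilityMeasure (μs i)) ∧ (∀ i, IsLevel (Ns i) (μs i)) ∧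
    (∀ i, ∀ᵐ u ∂(μs i), ‖u‖ ≤ R) ∧ (∀ i, IsPolyStationary ν f (Ns i) (μs i)) ∧
    ∀ Φ : H³ → ℝ, Continuous Φ → Bornology.IsBounded (Set.range Φ) →
      Tendsto (fun i => ∫ u, Φ u ∂(μs i)) atTop (𝓝 (∫ u, Φ u ∂μ))

/-- **C⁺ of card B (NS-level, no `N`): input-persistent bounded-energy Galerkin-limit stationary
statistical solutions along `ν_j → 0`.** -/
def InputPersistentVF : Prop :=
  ∃ f : 𝕋³ → E³, Torus.IsSmooth f ∧ Torus.IsDivFree f ∧ Torus.HasZeroMean f ∧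
    ∃ (ν : ℕ → ℝ) (E ε : ℝ), (∀ j, 0 < ν j) ∧ Tendsto ν atTop (𝓝 0) ∧ 0 < ε ∧
      ∀ j : ℕ, ∃ (R : ℝ) (μ : Measure H³), IsProbabilityMeasure μ ∧
        IsGalerkinLimit (ν j) f R μ ∧ (∀ᵐ u ∂μ, ‖u‖ ≤ R) ∧
        Torus.ensembleEnergy μ ≤ E ∧ ε ≤ ∫ (u : H³), Torus.pairing u.1 f ∂μ

/-- **B3 (transfer, provable now from B2 + continuity of `u ↦ min(‖u‖², R²)` and of the input on
the ball):** `C⁺ →` the loud rung `GalerkinInvariantLoud` (with budgets `E + 1`, `ε / 2`). -/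
def CardB_Transfer : Prop :=
  InputEqDissipation → InputPersistentVF →
    Summit.AnomalousDissipation.AnomalousDissipation.Theses.MomentParity.GalerkinInvariantLoud

/-- **B4 (converse direction, compactness):** loud invariant Galerkin families have Galerkin
limits with the same input and energy (Prokhorov in the norm topology of `H` via B1 and
`{Z ≤ M} ∩ B_R` compact; FMRT 2001 Ch. IV §1.3–§3). With B3: `GalerkinInvariantLoud ↔ C⁺`. -/
def CardB_Converse : Prop :=
  Summit.AnomalousDissipation.AnomalousDissipation.Theses.MomentParity.GalerkinInvariantLoud →
    InputPersistentVF

/-- Sanity: the two cards together re-derive the crux through the route's own glue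
(`LadderGlue : GalerkinInvariantLoud → ResolvedDissipation → MomentLadder`, item 14285), with
`ResolvedDissipation` replaced by the UI form of card A. Pure logic once `CardA_Glue` holds. -/
theorem cards_reach_crux (hA : CardA_Glue) (hUI : UIResolution) (h : GalerkinInvariantLoudUI) :
    Summit.AnomalousDissipation.AnomalousDissipation.Theses.MomentParity.MomentLadder :=
  hA hUI h

end Summit.AnomalousDissipation.AnomalousDissipation.Cruxes.MomentLadder.Ideate3

end
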